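import Summits.Ventures.QEC.CircuitDistance.SchedFamilyCeiling
import Summits.Ventures.QEC.CircuitDistance.SchedFamily936Complete
import HarnessLib

/-!
# `[[144,12,12]]` — THE FAMILY CEILING for EVERY VALID ORDER: `∀ σ, σ.Valid → ∀ Nc ≥ 1, circuitDistanceₛ σ bb144SM Nc ≤ 11`
# (and its `Nc = 1` instance under the R181 (2)(c) name `valid_circuitDistance_one_le_eleven`)
# (venture QEC, experiment cell CDX; the list form `SchedFamilyCeiling` composed with idea-2 g4's completeness theorem
# `SMSchedule.valid_iff_mem_family936` / `forall_valid_iff`; UPPER side only — nothing here asserts a value of `d_circ`)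

Provenance: typed by qec-cdx-type-1 g4 (2026-08-29); landing per director-qec R169 (3). IN MODEL (spec semantics of `SyndromeCycle` /
`SMSchedule`; `Valid := templateOK ∧ parityOK`, criterion O1 as landed): no CNOT order of print's depth-8 template keeps the code distance 12 at
the circuit level — every valid variant has an undetectable logical fault set of `≤ 11` operations at every `N_c ≥ 1`. RIDER L (numbering
ours; identification with print's enumeration OPEN, acq-14097) and EXT travel with any use; wording is the director's. Nothing here changes a
deployed code.
-/

namespace Summit.Ventures.QEC.CircuitDistance

namespace SMSchedule

/-- ★★ Every VALID depth-7 CNOT order has an undetectable logical fault set of `≤ 11` operations in the `Nc`-cycle circuit, every `Nc ≥ 1`. -/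
theorem hasAt_eleven_of_valid :
    ∀ σ : SMSchedule, σ.Valid → ∀ Nc : ℕ, 1 ≤ Nc → HasLogicalFaultOfWeightAtMostAtₛ σ bb144SM Nc 11 :=
  (forall_valid_iff (fun σ => ∀ Nc : ℕ, 1 ≤ Nc → HasLogicalFaultOfWeightAtMostAtₛ σ bb144SM Nc 11)).2 family936_hasAt_all

/-- ★★ THE FAMILY CEILING: `circuitDistanceₛ σ bb144SM Nc ≤ 11` for every valid order `σ` and every `Nc ≥ 1`. -/
theorem circuitDistanceₛ_le_eleven_of_valid :
    ∀ σ : SMSchedule, σ.Valid → ∀ Nc : ℕ, 1 ≤ Nc → circuitDistanceₛ σ bb144SM Nc ≤ 11 :=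
  (forall_valid_iff (fun σ => ∀ Nc : ℕ, 1 ≤ Nc → circuitDistanceₛ σ bb144SM Nc ≤ 11)).2 family936_circuitDistanceₛ_le

end SMSchedule

/-- ★★ R181 (2)(c) NAME, one cycle: `∀ σ : SMSchedule, σ.Valid → circuitDistanceₛ σ bb144SM 1 ≤ 11` (the `Nc = 1` instance of
`SMSchedule.circuitDistanceₛ_le_eleven_of_valid`). -/
theorem valid_circuitDistance_one_le_eleven : ∀ σ : SMSchedule, σ.Valid → circuitDistanceₛ σ bb144SM 1 ≤ 11 :=
  fun σ hσ => SMSchedule.circuitDistanceₛ_le_eleven_of_valid σ hσ 1 le_rfl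

end Summit.Ventures.QEC.CircuitDistance
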